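import Literature.NumberTheory.LFunctions.TuringMethodTrudgianIILehman

/-!
# Trudgian's Theorem 1 (Turing's method II) from Lehman's bound: evaluation of the certified chain

One compiled evaluation (`native_decide`) of
`Literature.NumberTheory.LFunctions.TrudgianIIChain.chainCheck` (see `TuringMethodTrudgianIILehman.lean`
for the checker, its data — `305` certified Euler–Maclaurin evaluations of `ζ(σ)` on `[1.07, 30]` at
scale `2^80` and `19` links — and its soundness theorem `sound_of_chainCheck`).  With it, Theorem 1 of
[Trudgian 2016] — the named fact `Literature.NumberTheory.LFunctions.abs_integral_zetaArgS_le_trudgianII`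
of `TuringMethod.lean`, `|∫_{t₁}^{t₂} S(t) dt| ≤ 1.698 + 0.183 log log t₂ + 0.049 log t₂` for
`t₂ > t₁ > 10⁵` — holds conditionally on ONE explicit bound for `ζ` on the line `σ = 1`: Patel's
`|ζ(1+it)| ≤ ½ log t + 1.93` for `t ≥ 3` [Patel2022, Thm 1.1], or `|ζ(1+it)| ≤ 0.6443 log t` for
`t ≥ e` [TeoZetaOneLine2024].  Everything else (Turing's lemma, Rademacher–Phragmén–Lindelöf,
Lehman's `2.53 t^{1/4}` on the critical line, the Hadamard-product lower bound with Booker's `log 4`,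
the numerics) is proved in the tree.  The only non-standard axiom of this file is the `native_decide`
auxiliary axiom of `TrudgianIIChain.chainCheck_eq_true` (trust in the Lean compiler), declared to the
gate as `computational`.

## References

* T. S. Trudgian, *Improvements to Turing's method II*, Rocky Mountain J. Math. 46 (2016),
  325–332, Thm 1.  [Trudgian2016]
* D. Patel, *An explicit upper bound for `|ζ(1+it)|`*, Indag. Math. 33 (2022), 1012–1032, Thm 1.1.
  [Patel2022]
* *Explicit bound of `|ζ(1+it)|`*, arXiv:2412.00766 (2024).  [TeoZetaOneLine2024]
-/

noncomputable section

open Complex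

namespace Literature.NumberTheory.LFunctions

/-- **The certified computation of the chain passes**: `chainCheck = true`.
[cite: Trudgian2016, Thm 1] -/
theorem TrudgianIIChain.chainCheck_eq_true : TrudgianIIChain.chainCheck = true := by
  native_decide

/-- **Trudgian 2016, Theorem 1, conditional on one bound on `σ = 1`** (`k₄ = 0.71`, `Q₀ = 10⁴`):
if `|ζ₁(1+iu)| ≤ 0.71 |10⁴+1+iu| log|10⁴+1+iu|` for all real `u` (`ζ₁(s) = (s−1)ζ(s)`), then
`|∫_{t₁}^{t₂} S(t) dt| ≤ 1.698 + 0.183 log log t₂ + 0.049 log t₂` for all `t₂ > t₁ > 10⁵`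
(`Literature.NumberTheory.LFunctions.abs_integral_zetaArgS_le_trudgianII`). [cite: Trudgian2016, Thm 1] -/
theorem abs_integral_zetaArgS_le_trudgianII_of_one_line
    (H2 : ∀ u : ℝ, ‖riemannZeta₁ (1 + u * I)‖ ≤
      0.71 * ‖((10000 : ℝ) : ℂ) + (1 + u * I)‖ * Real.log ‖((10000 : ℝ) : ℂ) + (1 + u * I)‖) :
    abs_integral_zetaArgS_le_trudgianII :=
  abs_integral_zetaArgS_le_trudgianII_of_chainCheck TrudgianIIChain.chainCheck_eq_true H2

/-- **Trudgian 2016, Theorem 1, from Patel's bound on `σ = 1`**: `|ζ(1+it)| ≤ ½ log t + 1.93` for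
`t ≥ 3` [Patel2022, Thm 1.1] implies `|∫_{t₁}^{t₂} S(t) dt| ≤ 1.698 + 0.183 log log t₂ + 0.049 log t₂`
for `t₂ > t₁ > 10⁵` (`Literature.NumberTheory.LFunctions.abs_integral_zetaArgS_le_trudgianII`).
[cite: Trudgian2016, Thm 1] [cite: Patel2022, Thm 1.1] -/
theorem abs_integral_zetaArgS_le_trudgianII_of_patel
    (h : ∀ t : ℝ, 3 ≤ t → ‖riemannZeta (1 + t * I)‖ ≤ 1 / 2 * Real.log t + 1.93) :
    abs_integral_zetaArgS_le_trudgianII :=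
  abs_integral_zetaArgS_le_trudgianII_of_one_line (trudgianII_H2_of_patel h)

/-- **Trudgian 2016, Theorem 1, from `|ζ(1+it)| ≤ 0.6443 log t` (`t ≥ e`)** [TeoZetaOneLine2024]:
that bound implies `|∫_{t₁}^{t₂} S(t) dt| ≤ 1.698 + 0.183 log log t₂ + 0.049 log t₂` for
`t₂ > t₁ > 10⁵` (`Literature.NumberTheory.LFunctions.abs_integral_zetaArgS_le_trudgianII`).
[cite: Trudgian2016, Thm 1] [cite: TeoZetaOneLine2024, Abstract] -/
theorem abs_integral_zetaArgS_le_trudgianII_of_le_log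
    (h : ∀ t : ℝ, Real.exp 1 ≤ t → ‖riemannZeta (1 + t * I)‖ ≤ 0.6443 * Real.log t) :
    abs_integral_zetaArgS_le_trudgianII :=
  abs_integral_zetaArgS_le_trudgianII_of_one_line (trudgianII_H2_of_le_log h)

end Literature.NumberTheory.LFunctions

end
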